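import Summits.CriticalPhenomena.PercolationContinuityZ3.Theorems.Transplant.SkelConcRootRun
import Summits.CriticalPhenomena.PercolationContinuityZ3.Theorems.Transplant.SkelConcExcess
import Summits.CriticalPhenomena.PercolationContinuityZ3.Theorems.Transplant.SkelWinChainT
import Summits.CriticalPhenomena.PercolationContinuityZ3.Theorems.Transplant.KNCellsBoxProdZ2ChainRoom
import HarnessLib

/-!
# L6 (R), file 3: plumbing of the root run over a `PlanarSkeletonConc` — levels / widths / PLANAR ROOMS of the straight-run and corridor
# window chains (`WinAdvData`, `WinChainData`), the regions of `Skel.rootWAD` inside the cut root world `rootUS` and off the wired root cube,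
# the root law `W0sub rootUS` a subbox weighting of the window graph on them and `0` off `G.edgeSet`, and the RIM EXCESS of the root run
# (`real_rim_le_rootSG`, from hp-8 g22's `Skel.real_rim_le_of_radius`) — generic twin of `KNCellsBoxProdZ2ConcRootKits` §1–2 +
# `KNCellsBoxProdZ2ChainRoom` + `KNCellsBoxProdZ2ConcRootReal` §1–2.  (The kit clauses `hkits_rootWAD` wait for L5.15 `SkelConcKits`.)

builds on p205010 (kernel theorem, internal audit signed; external expert review pending) — nothing in this file uses p205010.
Status sentence (coordinator 2026-08-20T04:30Z): "θ(p_c) = 0 on ℤ^d, all d ≥ 2 — kernel-verified (Lean 4/Mathlib, standard axioms); internal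
adversarial audit SIGNED 2026-08-20 04:29Z; external expert review pending."
Lane `prim-bschramm-*`, seat `prim-bschramm-p2` (gen 4; (R) = p2 lineage, SHEAR-SCOPE §3.9 Layer 6); helper file (`--supports stmt-CriticalPhenomena-4575`).

* §1 `WinAdvData.level_subset_stepD`; record-free planar forms `ChainPlanar.Adv.levelBox_wide`, **`ChainPlanar.Adv.levelBox_room`**,
  **`ChainPlanar.Sched.levelBox_room`** (usable by every record — Tube*, Win*, Hab*; planar rooms in p3's `hroom` shape:
  for every level point a route scale `ℓ ∈ [ℓ₀, ℓ₁]` with its square inside the planar region and a quarter-face inside the next planar core);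
* §2 `rootUS` (the cut root world `(Q_0 ∪ E_{0,du}) ∩ B_G(w₀, Rt)`), `rootWAD_stepD_subset_rootUS`, `rootWAD_stepD_disjoint_Q`, `isSubbox_rootWAD`,
  `Q_subset_rootUS`, `W0sub_eq_zero_of_not_mem_edgeSet`, `φ_sub_φ_mem_box_of_mem_rootUS`;
* §3 **`real_rim_le_rootSG`** — under the cut root law, `P(⋃_{z ∈ Rim_k} w₀ ↔ z) ≤ η` for every step `k ≤ 44`, given an excess radius
  `R₁ ≤ Rt − L'` at the running parameter for entrances at depth `E₀ + 1` (`rQ 0 0 ≤ E₀`) and habitats of planar diameter `60r ≤ m`.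
[cite: KozmaNitzan2024, §4 p. 27 (G₀), p. 28 ((32) at the root), Lemma 10 (p. 17), Lemma 11 (pp. 22–23), Lemma 12 (p. 24)]
-/

noncomputable section

open MeasureTheory ProbabilityTheory
open scoped ENNReal Classical

namespace Summit.CriticalPhenomena.PercolationContinuityZ3.Theorems

namespace Transplant

namespace Skel

open Literature.Probability.Percolation Literature.Probability.LatticeModels SimpleGraph GadgetSystem ProbeHistory HSiteScheme Contour KNCells
open Literature.Probability.Percolation.KozmaNitzan
open Literature.Probability.Percolation.KozmaNitzan.Cells (sgOf sgOf_sign)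
open KNCells.KSchA PlanarSkeletonConc KNLevels ChainPlanar
open Literature.Barriers.CriticalPhenomena (graphBall mem_graphBall_self graphBall_mono)
open BoxProdZ2 (ConcRadiiG rootρ rootCtr RootRunOK RootRunOKN rootRun_advOK rootRun_region_subset_N rootRun_region_disjoint_Q
  rootRun_last_subset_M natAbs_add_le_of_mem_root_region abs_apply_le_of_mem_Cells_root)

variable {V : Type} {G : SimpleGraph V} [G.LocallyFinite] (Φ : PlanarSkeletonConc G)

/-! ## §1 Levels, widths and planar rooms of the window chains -/

namespace WinAdvData

/-- **The levels `j ≤ j₁` of step `k` lie in its region** (`j₁ ≤ Rlev`, `Rlev + 1 ≤ R'`, `k ≤ nA`). [cite: KozmaNitzan2024, §4 Lemma 10 (p. 17: B⟨j⟩ ⊆ D)] -/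
theorem level_subset_stepD (P : WinAdvData V) (hsg : P.sg = 1 ∨ P.sg = -1) (hOK : Adv.AdvOK P.q P.q' P.s₁ P.ρ P.R' P.ℓ₀ P.nA)
    (hRl : P.Rlev + 1 ≤ P.R') (hj : P.j₁ ≤ P.Rlev) {k : ℕ} (hk : k ≤ P.nA) {j : ℕ} (hjj : j ≤ P.j₁) :
    (P.stepL Φ k).X j ⊆ P.stepD Φ k := by
  rw [P.stepL_X Φ hsg, WinAdvData.stepD]
  have hjR : (j : ℤ) ≤ P.R' := by exact_mod_cast (hjj.trans hj).trans (by omega : P.Rlev ≤ P.R')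
  exact Φ.Win_mono ((sBox_mono hsg _ (by linarith) (by linarith) (by linarith)).trans (Adv.enlarge_core_subset_region hsg _ hOK hk)) le_rfl

end WinAdvData

/-! ### Record-free planar forms (shared by the product records and the window/habitat records) -/

/-- **Every level `j ≥ M + 1` of every core of a straight run is at least `2M + 2` wide in each coordinate** (record-free form of
`TubeAdvData.wide`). [folklore] -/
theorem _root_.Summit.CriticalPhenomena.PercolationContinuityZ3.Theorems.Transplant.ChainPlanar.Adv.levelBox_wide
    {q q' s₁ ρ : ℤ} {R' ℓ₀ nA : ℕ} {ax : Fin 2} {sg : ℤ} {c : Site 2} (hsg : sg = 1 ∨ sg = -1) (hOK : Adv.AdvOK q q' s₁ ρ R' ℓ₀ nA)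
    (k : ℕ) {M j : ℕ} (hMj : M + 1 ≤ j) :
    ∀ i, (sLo ax sg c (Adv.coreα q s₁ k) (Adv.coreβ q s₁ k) (Adv.coreW q q' s₁ R' k) - ((j : ℕ) : Site 2)) i + 2 * M + 2 ≤
      (sHi ax sg c (Adv.coreα q s₁ k) (Adv.coreβ q s₁ k) (Adv.coreW q q' s₁ R' k) + ((j : ℕ) : Site 2)) i := by
  intro i
  have hne := Adv.core_nonempty hsg c hOK k (q := q) (q' := q') (s₁ := s₁) (R' := R') (a := ax)
  have hle := (Finset.nonempty_Icc.1 hne) i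
  have hMj' : (M : ℤ) + 1 ≤ j := by exact_mod_cast hMj
  simp only [Pi.sub_apply, Pi.add_apply, Pi.natCast_apply]
  linarith

/-- **THE PLANAR ROOM OF A STRAIGHT RUN**, record-free (p3's `hroom`): for `k ≤ nA`, every level `j ≤ j₁` (`j₁ ≤ Rlev`, `Rlev + 1 ≤ R'`) and
every `v` in the level box there is `ℓ ∈ [ℓ₀, ℓ₁]` (any `ℓ₁ ≥ 2q + s₁ + R'`) with `(box 2 ℓ).image (· + v) ⊆ region k` and a quarter-face
`(orthantFace ax τ ℓ).image (· + v) ⊆ core (k + 1)`. [cite: KozmaNitzan2024, §4 Lemma 11 (pp. 22–23)] -/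
theorem _root_.Summit.CriticalPhenomena.PercolationContinuityZ3.Theorems.Transplant.ChainPlanar.Adv.levelBox_room
    {q q' s₁ ρ : ℤ} {R' ℓ₀ nA Rlev j₁ : ℕ} {ax : Fin 2} {sg : ℤ} {c : Site 2} (hsg : sg = 1 ∨ sg = -1)
    (hOK : Adv.AdvOK q q' s₁ ρ R' ℓ₀ nA) (hRl : Rlev + 1 ≤ R') (hj : j₁ ≤ Rlev) {ℓ₁ : ℕ} (hℓ₁ : 2 * q + s₁ + R' ≤ ℓ₁) {k : ℕ} (hk : k ≤ nA) :
    ∀ j, j ≤ j₁ → ∀ v ∈ Finset.Icc (sLo ax sg c (Adv.coreα q s₁ k) (Adv.coreβ q s₁ k) (Adv.coreW q q' s₁ R' k) - ((j : ℕ) : Site 2))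
      (sHi ax sg c (Adv.coreα q s₁ k) (Adv.coreβ q s₁ k) (Adv.coreW q q' s₁ R' k) + ((j : ℕ) : Site 2)), ∃ ℓ, ℓ₀ ≤ ℓ ∧ ℓ ≤ ℓ₁ ∧
      (box 2 ℓ).image (fun t => t + v) ⊆ Adv.region q s₁ ρ ax sg c k ∧
      ∃ (a : Fin 2) (τ' : Fin 2 → ℤˣ), (orthantFace a τ' ℓ).image (fun t => t + v) ⊆ Adv.core q q' s₁ R' ax sg c (k + 1) := by
  intro j hjj v hv
  rw [sBox_enlarge _ _ hsg] at hv
  have hjR : (j : ℤ) ≤ R' := by exact_mod_cast (hjj.trans hj).trans (by omega : Rlev ≤ R')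
  have hv' : v ∈ sBox ax sg c (Adv.coreα q s₁ k - R') (Adv.coreβ q s₁ k + R') (Adv.coreW q q' s₁ R' k + R') :=
    sBox_mono hsg _ (by linarith) (by linarith) (by linarith) hv
  obtain ⟨ℓ, hℓ0, hℓ1, hsq, τ, hface⟩ := Adv.core_route_le hsg c hOK hk hv'
  have hℓ1' : ℓ ≤ ℓ₁ := by
    have : (ℓ : ℤ) ≤ ℓ₁ := hℓ1.trans hℓ₁
    exact_mod_cast this
  exact ⟨ℓ, hℓ0, hℓ1', hsq, ax, τ, hface⟩

/-- **THE PLANAR ROOM OF THE CORRIDOR CHAIN**, record-free (`ℓ₁ := 6t`; levels `j ≤ j₁ ≤ Rlev`, `Rlev + 1 ≤ R'`, `100 R' ≤ t`, `R' + ℓ₀ ≤ t`,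
steps `i ≤ 86`). [cite: KozmaNitzan2024, §4 Lemma 11 (pp. 22–23), Lemma 12 (pp. 23–25)] -/
theorem _root_.Summit.CriticalPhenomena.PercolationContinuityZ3.Theorems.Transplant.ChainPlanar.Sched.levelBox_room
    {t R' Rlev j₁ : ℕ} {du : MDir} {cen : Site 2} (hR : 100 * R' ≤ t) (hRl : Rlev + 1 ≤ R') (hj : j₁ ≤ Rlev) {ℓ₀ : ℕ}
    (hℓ : R' + ℓ₀ ≤ t) {i : ℕ} (hi : i ≤ Sched.nLast) :
    ∀ j, j ≤ j₁ → ∀ v ∈ Finset.Icc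
      (sLo du.1 (sgOf du) cen (Sched.coreα t R' i) (Sched.coreβ t R' i) (Sched.coreW t R' i) - ((j : ℕ) : Site 2))
      (sHi du.1 (sgOf du) cen (Sched.coreα t R' i) (Sched.coreβ t R' i) (Sched.coreW t R' i) + ((j : ℕ) : Site 2)),
      ∃ ℓ, ℓ₀ ≤ ℓ ∧ ℓ ≤ 6 * t ∧ (box 2 ℓ).image (fun s => s + v) ⊆ Sched.region t R' du.1 (sgOf du) cen i ∧
      ∃ (a : Fin 2) (τ' : Fin 2 → ℤˣ), (orthantFace a τ' ℓ).image (fun s => s + v) ⊆ Sched.core t R' du.1 (sgOf du) cen (i + 1) := by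
  intro j hjj v hv
  rw [sBox_enlarge _ _ (sgOf_sign du)] at hv
  have hjR : (j : ℤ) ≤ R' := by exact_mod_cast (hjj.trans hj).trans (by omega : Rlev ≤ R')
  have hv' : v ∈ sBox du.1 (sgOf du) cen (Sched.coreα t R' i - R') (Sched.coreβ t R' i + R') (Sched.coreW t R' i + R') :=
    sBox_mono (sgOf_sign du) _ (by linarith) (by linarith) (by linarith) hv
  obtain ⟨ℓ, hℓ0, hℓ1, hsq, a, τ, hface⟩ := Sched.core_route_le (sgOf_sign du) cen hR hℓ hi hv'
  exact ⟨ℓ, hℓ0, hℓ1, hsq, a, τ, hface⟩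

/-! ## §2 The root run inside the cut root world -/

variable [DecidableEq V]

/-- **The cut root world** of direction `du`: `(Q_0 ∪ E_{0,du}) ∩ B_G(w₀, Rt)` (regions of record: spans). [cite: KozmaNitzan2024, §4 p. 28 ((32) at the root)] -/
def rootUS (C : PCells) (w₀ : V) (Λ : ConcRadiiG) (q : unitInterval) (δc : ℝ) (Rt : ℕ) (du : MDir) : Finset V :=
  ((⟨cellGeomSG Φ C w₀ Λ, q, δc⟩ : KSchA V ℕ).U0root du).filter fun y => y ∈ graphBall G w₀ Rt

section Root

variable {C : PCells} {w₀ : V} {Λ : ConcRadiiG} {q : unitInterval} {δc : ℝ} {Rt L' t R' ℓ₀ Rlev N j₀ j₁ : ℕ} {du : MDir} {ca cb q' : ℤ}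

/-- **Every region of the root run lies in the cut root world** (radius facts with one unit of slack: the step device puts a window vertex over
`BtwN` / `Q_{0+du}` into the span). [cite: KozmaNitzan2024, §4 p. 28] -/
theorem rootWAD_stepD_subset_rootUS (h : RootRunOKN C t R' ℓ₀ ca cb q') (hRB : Rt + 1 ≤ Λ.rB 0 0 du)
    (hRQ : Rt + 1 ≤ Λ.rQ 0 ((0 : Site 2) + stepVec du)) {k : ℕ} (hk : k ≤ 44) {Sfin : Finset V} :
    (rootWAD Φ w₀ Rt L' du t R' ℓ₀ ca cb q' Rlev N j₀ j₁ Sfin).stepD Φ k ⊆ rootUS Φ C w₀ Λ q δc Rt du := by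
  intro v hv
  change v ∈ Φ.Win w₀ (Adv.region 0 (t : ℤ) (rootρ t R' q') du.1 (sgOf du) (rootCtr du ca cb) k) Rt at hv
  obtain ⟨hd, hφv⟩ := Φ.mem_Win.1 hv
  refine Finset.mem_filter.2 ⟨?_, hd⟩
  rcases Finset.mem_union.1 (rootRun_region_subset_N h hk hφv) with hB | hQ
  · refine Finset.mem_union_right _ (Finset.mem_union_left _ ?_)
    change v ∈ Φ.VWin w₀ (C.BtwN 0 du) (Λ.rB 0 0 du)
    exact Φ.mem_VWin_of_zdAdj hd hRB hB (C.exists_adj_of_mem_BtwN 0 du hB)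
  · refine Finset.mem_union_right _ (Finset.mem_union_right _ ?_)
    change v ∈ Φ.VWin w₀ (C.Q ((0 : Site 2) + stepVec du)) (Λ.rQ 0 ((0 : Site 2) + stepVec du))
    exact Φ.mem_VWin_of_zdAdj hd hRQ hQ (C.exists_adj_of_mem_Q _ hQ)

/-- **Every region of the root run is off the wired root cube** (planar footprints). [cite: KozmaNitzan2024, §4 p. 28] -/
theorem rootWAD_stepD_disjoint_Q (h : RootRunOK C t R' ℓ₀ ca cb q') {k : ℕ} (hk : k ≤ 44) {Sfin : Finset V} :
    Disjoint ((rootWAD Φ w₀ Rt L' du t R' ℓ₀ ca cb q' Rlev N j₀ j₁ Sfin).stepD Φ k)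
      ((⟨cellGeomSG Φ C w₀ Λ, q, δc⟩ : KSchA V ℕ).Γ.Q (⟨cellGeomSG Φ C w₀ Λ, q, δc⟩ : KSchA V ℕ).Γ.a₀ 0) := by
  change Disjoint (Φ.Win w₀ (Adv.region 0 (t : ℤ) (rootρ t R' q') du.1 (sgOf du) (rootCtr du ca cb) k) Rt) (Φ.VWin w₀ (C.Q 0) (Λ.rQ 0 0))
  exact disjoint_of_φ (fun a ha => (Φ.mem_Win.1 ha).2) (fun b hb => φ_mem_of_mem_VWin hb) (rootRun_region_disjoint_Q h hk)

/-- **The root law cut to the ball is a subbox weighting of the window graph on every region of the root run.**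
[cite: KozmaNitzan2024, §4 p. 17 (subbox), p. 28] -/
theorem isSubbox_rootWAD (h : RootRunOKN C t R' ℓ₀ ca cb q') (hRB : Rt + 1 ≤ Λ.rB 0 0 du) (hRQ : Rt + 1 ≤ Λ.rQ 0 ((0 : Site 2) + stepVec du))
    {k : ℕ} (hk : k ≤ 44) {Sfin : Finset V} :
    IsSubbox (winGraph G w₀ Rt) ((⟨cellGeomSG Φ C w₀ Λ, q, δc⟩ : KSchA V ℕ).W0sub G (rootUS Φ C w₀ Λ q δc Rt du)) q
      ((rootWAD Φ w₀ Rt L' du t R' ℓ₀ ca cb q' Rlev N j₀ j₁ Sfin).stepD Φ k) :=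
  isSubbox_W0sub_win G w₀ Rt (S := (⟨cellGeomSG Φ C w₀ Λ, q, δc⟩ : KSchA V ℕ)) (U := (⟨cellGeomSG Φ C w₀ Λ, q, δc⟩ : KSchA V ℕ).U0root du)
    (rootWAD_stepD_subset_rootUS Φ h hRB hRQ hk) (rootWAD_stepD_disjoint_Q Φ h.toRootRunOK hk)

/-- **The wired root cube lies in the cut root world** once `rQ 0 0 ≤ Rt`. [folklore] -/
theorem Q_subset_rootUS (hQR : Λ.rQ 0 0 ≤ Rt) :
    (⟨cellGeomSG Φ C w₀ Λ, q, δc⟩ : KSchA V ℕ).Γ.Q (⟨cellGeomSG Φ C w₀ Λ, q, δc⟩ : KSchA V ℕ).Γ.a₀ 0 ⊆ rootUS Φ C w₀ Λ q δc Rt du := by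
  intro z hz
  refine Finset.mem_filter.2 ⟨Finset.mem_union_left _ hz, ?_⟩
  change z ∈ Φ.VWin w₀ (C.Q 0) (Λ.rQ 0 0) at hz
  exact graphBall_mono G w₀ hQR (mem_graphBall_of_mem_VWin hz)

omit [G.LocallyFinite] in
/-- The cut root law gives weight `0` to every non-edge of `G`. [folklore] -/
theorem W0sub_eq_zero_of_not_mem_edgeSet [G.LocallyFinite] (S : KSchA V ℕ) (U' : Finset V) {e : Sym2 V} (he : e ∉ G.edgeSet) :
    S.W0sub G U' e = 0 := by
  by_cases hU : e ∈ wireSet (↑U' : Set V)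
  · have hF : e ∉ S.U₀ G := by
      intro h'
      rw [KSchA.U₀, mem_edgesIn_iff] at h'
      exact he h'.1
    rw [W0sub_apply_of_mem hU hF, KNLevels.lattW_apply, if_neg he]
  · unfold KSchA.W0sub
    exact restrW_apply_of_not_mem _ hU

/-- **The fresh root world has planar diameter `≤ 60r`**: two vertices of `rootUS ∖ Q_0` have footprints in `C.Cell 0 ∪ C.Cell (0+du)`.
[folklore] -/
theorem φ_sub_φ_mem_box_of_mem_rootUS {m : ℕ} (hm : 60 * C.r ≤ m) {d d' : V}
    (hd : d ∈ rootUS Φ C w₀ Λ q δc Rt du \ (⟨cellGeomSG Φ C w₀ Λ, q, δc⟩ : KSchA V ℕ).Γ.Q (⟨cellGeomSG Φ C w₀ Λ, q, δc⟩ : KSchA V ℕ).Γ.a₀ 0)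
    (hd' : d' ∈ rootUS Φ C w₀ Λ q δc Rt du \ (⟨cellGeomSG Φ C w₀ Λ, q, δc⟩ : KSchA V ℕ).Γ.Q (⟨cellGeomSG Φ C w₀ Λ, q, δc⟩ : KSchA V ℕ).Γ.a₀ 0) :
    Φ.φ d - Φ.φ d' ∈ box 2 m := by
  -- footprints of the fresh root world lie in `C.Cell 0 ∪ C.Cell (0 + du)`
  have key : ∀ {y : V}, y ∈ rootUS Φ C w₀ Λ q δc Rt du \
      (⟨cellGeomSG Φ C w₀ Λ, q, δc⟩ : KSchA V ℕ).Γ.Q (⟨cellGeomSG Φ C w₀ Λ, q, δc⟩ : KSchA V ℕ).Γ.a₀ 0 →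
      Φ.φ y ∈ C.Cell 0 ∪ C.Cell ((0 : Site 2) + stepVec du) := by
    intro y hy
    obtain ⟨hyU, hyQ⟩ := Finset.mem_sdiff.1 hy
    obtain ⟨hyU0, -⟩ := Finset.mem_filter.1 hyU
    rcases Finset.mem_union.1 hyU0 with hyQ' | hyE
    · exact absurd hyQ' hyQ
    · change y ∈ Φ.VWin w₀ (C.BtwN 0 du) (Λ.rB 0 0 du) ∪ Φ.VWin w₀ (C.Q ((0 : Site 2) + stepVec du)) (Λ.rQ 0 ((0 : Site 2) + stepVec du)) at hyE
      rcases Finset.mem_union.1 hyE with hyB | hyQ2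
      · exact C.BtwN_subset_Cells 0 du (φ_mem_of_mem_VWin hyB)
      · exact Finset.mem_union_right _ (C.Q_subset_Cell _ (φ_mem_of_mem_VWin hyQ2))
  have hm' : (60 : ℤ) * C.r ≤ m := by exact_mod_cast hm
  rw [mem_box]
  intro i
  have h1 := abs_apply_le_of_mem_Cells_root C du (key hd) i
  have h2 := abs_apply_le_of_mem_Cells_root C du (key hd') i
  rw [abs_le] at h1 h2
  simp only [Pi.sub_apply]
  constructor <;> linarith [h1.1, h1.2, h2.1, h2.2]

/-! ## §3 The rim excess of the root run -/

/-- **THE RIM EXCESS OF THE ROOT RUN**: under the cut root law, `P(⋃_{z ∈ Rim_k} w₀ ↔ z) ≤ η` for every step `k ≤ 44`, given an excess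
radius `R₁ ≤ Rt − L'` at the running parameter for entrances at depth `E₀ + 1` (the wired root cube has depth `rQ 0 0 ≤ E₀`) and habitats of
planar diameter `m ≥ 60r` (the shape of `Skel.exists_excess_radius_uniform` at the centre `w₀`). [cite: KozmaNitzan2024, §4 Lemma 12 (p. 24), p. 28] -/
theorem real_rim_le_rootSG [Countable V] (hΛ : WFS C Λ) (hφ : Φ.φ w₀ = 0) (h : RootRunOKN C t R' ℓ₀ ca cb q') (hRB : Rt + 1 ≤ Λ.rB 0 0 du)
    (hRQ : Rt + 1 ≤ Λ.rQ 0 ((0 : Site 2) + stepVec du)) {E₀ : ℕ} (hQ0 : Λ.rQ 0 0 ≤ E₀) {m : ℕ} (hm : 60 * C.r ≤ m) {η : ℝ} {R₁ : ℕ}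
    (hR₁ : ∀ R'', R₁ ≤ R'' → ∀ (Rw : ℕ) (D' A' : Finset V), (∀ d ∈ D', d ∈ graphBall G w₀ Rw) →
      (∀ d ∈ D', ∀ d' ∈ D', Φ.φ d - Φ.φ d' ∈ box 2 m) → A' ⊆ D' → (∀ a ∈ A', a ∈ graphBall G w₀ (E₀ + 1)) →
        (bondPercolation G q).real (excess G w₀ R'' D' A') ≤ η)
    (hR : R₁ ≤ Rt - L') {k : ℕ} (hk : k ≤ 44) :
    (prodBernoulli ((⟨cellGeomSG Φ C w₀ Λ, q, δc⟩ : KSchA V ℕ).W0sub G (rootUS Φ C w₀ Λ q δc Rt du))).real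
      (⋃ z ∈ (rootWAD Φ w₀ Rt L' du t R' ℓ₀ ca cb q' Rlev N j₀ j₁ (rootUS Φ C w₀ Λ q δc Rt du)).Rim k, openConn w₀ z) ≤ η := by
  set S : KSchA V ℕ := ⟨cellGeomSG Φ C w₀ Λ, q, δc⟩ with hSdef
  set U' := rootUS Φ C w₀ Λ q δc Rt du with hU'
  set P := rootWAD Φ w₀ Rt L' du t R' ℓ₀ ca cb q' Rlev N j₀ j₁ U' with hP
  set D : Finset V := U' \ S.Γ.Q S.Γ.a₀ 0 with hD
  have hsg : P.sg = 1 ∨ P.sg = -1 := sgOf_sign du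
  -- the fresh root world is a subbox of the window graph
  have hWD : IsSubbox (winGraph G w₀ Rt) (S.W0sub G U') q D :=
    isSubbox_W0sub_win G w₀ Rt (S := S) (U := S.U0root du) Finset.sdiff_subset Finset.sdiff_disjoint
  have hDπ : ∀ v ∈ D, v ∈ graphBall G w₀ Rt := fun v hv => (Finset.mem_filter.1 (Finset.mem_sdiff.1 hv).1).2
  have hWG : ∀ e, e ∉ G.edgeSet → S.W0sub G U' e = 0 := fun e he => W0sub_eq_zero_of_not_mem_edgeSet S U' he
  have hrootQ : w₀ ∈ S.Γ.Q S.Γ.a₀ 0 := (sepGeomSG Φ C w₀ hΛ hφ).root_mem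
  have hroot : w₀ ∉ D := fun h' => (Finset.mem_sdiff.1 h').2 hrootQ
  have hRimD : P.Rim k ⊆ D := by
    intro z hz
    have hz' : z ∈ P.stepD Φ k := rootWAD_Rim_subset Φ w₀ Rt L' du t R' ℓ₀ ca cb q' Rlev N j₀ j₁ U' k hz
    exact Finset.mem_sdiff.2 ⟨rootWAD_stepD_subset_rootUS Φ h hRB hRQ hk hz',
      Finset.disjoint_left.1 (rootWAD_stepD_disjoint_Q Φ (Λ := Λ) (q := q) (δc := δc) h.toRootRunOK hk) hz'⟩
  have hRimfar : ∀ z ∈ P.Rim k, z ∉ graphBall G w₀ (Rt - L') := fun z hz => not_mem_graphBall_of_mem_rootWAD_Rim Φ hz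
  -- entrances come from the wired root cube (depth `≤ rQ 0 0 ≤ E₀`)
  have hA : ∀ a b, a ∉ D → b ∈ D → G.Adj a b → S.W0sub G U' s(a, b) ≠ 0 → b ∈ graphBall G w₀ (E₀ + 1) := by
    intro a b ha hb hadj hw
    have haU : a ∈ U' := by
      by_contra haU
      apply hw
      unfold KSchA.W0sub
      exact restrW_apply_of_not_mem _ (fun h' => haU (Finset.mem_coe.1 (h'.1 a (Sym2.mem_mk_left _ _))))
    have haQ : a ∈ S.Γ.Q S.Γ.a₀ 0 := by
      by_contra haQ
      exact ha (Finset.mem_sdiff.2 ⟨haU, haQ⟩)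
    have ha1 : a ∈ graphBall G w₀ E₀ := by
      change a ∈ Φ.VWin w₀ (C.Q 0) (Λ.rQ 0 0) at haQ
      exact graphBall_mono G w₀ hQ0 (mem_graphBall_of_mem_VWin haQ)
    exact BoxProdZ2.mem_graphBall_succ_of_adj G ha1 hadj
  -- hp-8 g22's `real_rim_le_of_radius` is stated with the classical `DecidableEq` instance (inside `IsSubbox` and `excess`); bridge by
  -- subsingleton-ness of instances (p3-g4's ruling (3), 19:11:29Z)
  refine real_rim_le_of_radius Φ (Wt := S.W0sub G U') (q := q) (D := D) (root := w₀) (w₀ := w₀) (R := Rt) (L' := L') (R₀' := E₀ + 1)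
    (Rim := P.Rim k) (m := m) (η := η) (R₁ := R₁) (by convert hWD) hDπ hWG hroot hRimD hRimfar hA ?_ hR (Rw := Rt) hDπ
    (fun d hd d' hd' => φ_sub_φ_mem_box_of_mem_rootUS Φ hm hd hd')
  intro R'' hR'' Rw D' A' h1 h2 h3 h4
  convert hR₁ R'' hR'' Rw D' A' h1 h2 h3 h4 using 3

end Root

end Skel

end Transplant

end Summit.CriticalPhenomena.PercolationContinuityZ3.Theorems

end
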